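import Mathlib
import Summits.Langlands.Langlands.Theorems.PicardMuOrdinaryIrregularClassicalityAlgebraicHeckeUntwist
import Literature.NumberTheory.Automorphic.AutomorphicTwistHecke
import Literature.NumberTheory.GaloisRepresentations.EisensteinPrimaryHeckeCharacter
import Literature.NumberTheory.GaloisRepresentations.CubicResidueSymbol
import HarnessLib

/-!
# Stub L `stub_limitTwist` of the line `slope-free-polarized-limit` (crux `IrregularClassicality`,
# stmt-Langlands-13758): the Grössencharacter twist of the typed `3`-adic tower

Helper file of the line `slope-free-polarized-limit` for the crux
`Summit.Langlands.Langlands.Theses.PicardMuOrdinary.IrregularClassicality` (stmt-Langlands-13758),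
proving its registered Stub L (= child `LimitTwist` of the strategist's prepared split): the TYPED
slope-free tower of regular algebraic cuspidal `P_k` on `GL₃(𝔸_K)`, `K = ℚ(ω)`, congruent to the
Picard traces `e(a_𝔭 f)` in Satake sums modulo `3^k` off a finite `S`, yields a tower of the same
shape for the TWISTED traces `e(a_𝔭 f · ϖ_𝔭)`, `ϖ_𝔭` the primary generator of `𝔭` (`ϖ_𝔭 ≡ 1 mod 3`).

Proof (Borel–Jacquet 1979, 5.7; Arthur–Clozel 1989, Ch. 3 p. 172; Ireland–Rosen Ch. 18 §4):
`P_k ↦ P_k ⊗ (ψ ∘ det)` with `ψ` the algebraic Hecke character of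
`exists_primaryGen_heckeCharacter_cyclotomicField_three e` (`ψ(ϖ_𝔭) = e(ϖ_𝔭)`, unramified off `3`).
Everything needed is already in the tree: the twist of a Borel–Jacquet cuspidal datum by an
ARBITRARY Hecke character (`exists_cuspidalAutomorphicRepData_twist_hecke`) with its Satake
parameters `ψ(ϖ_v) · α` at the good places (`HasSatakeParamAt.map_mulChar_detTwist_hecke_of_isUnramifiedAt`),
and the infinity type of the twist by an ALGEBRAIC character (`hasInfinityType_twist_hecke`: shift by
the integers `n_σ`), whence regular algebraicity is kept (`isRegularAlgebraic_twist_hecke` below).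
The congruence scales: `t ↦ e(ϖ_𝔭) t` (an algebraic integer multiple), same `u`; the exceptional
set grows by the primes of a level `𝔪` of `ψ ∘ det` and the prime above `3`.
-/

open scoped Classical
open NumberField Filter IsDedekindDomain Polynomial
open Literature.NumberTheory.Automorphic Literature.NumberTheory.GaloisRepresentations
open Summit.Langlands.Langlands.Theorems.IrregularClassicality.SplitRamifiedPrimeSqrt6

set_option linter.dupNamespace false -- project-wide option; `Summit.Langlands.Langlands` is the mandated namespace
set_option autoImplicit false

noncomputable section

namespace Summit.Langlands.Langlands.Theorems.IrregularClassicality.SlopeFreePolarizedLimit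

variable {n : ℕ} {K : Type} [Field K] [NumberField K] {hcpt : isCompact_glFiniteIntegralLevel n K}

/-- **Twisting by an algebraic Hecke character preserves regular algebraicity** (Clozel 1990,
Déf. 1.8, 3.12; Borel–Jacquet 1979, 5.7): the infinity type of `π ⊗ (θ ∘ det)` is that of `π`
shifted at each embedding `σ` by the integer `n_σ` (`hasInfinityType_twist_hecke`), which keeps the
exponents in `(n-1)/2 + ℤ` and pairwise distinct. -/
theorem isRegularAlgebraic_twist_hecke {θ : HeckeCharacter K} (hθ : θ.IsAlgebraic)
    {π π' : AutomorphicRepData (AutomorphyDatum.gl n K hcpt)}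
    (hW : π'.W = π.W.map (mulChar (detTwist n θ)))
    (hW' : π'.W' = π.W'.map (mulChar (detTwist n θ))) (hπ : π.IsRegularAlgebraic) :
    π'.IsRegularAlgebraic := by
  obtain ⟨p, q, hθ⟩ := (HeckeCharacter.isAlgebraic_iff_exists_hasInfinityType θ).mp hθ
  obtain ⟨T, hT, hTC, hTR⟩ := hπ
  obtain ⟨T', hT', hTT'⟩ := hasInfinityType_twist_hecke hθ hW hW' hT
  refine ⟨T', hT', fun σ w hw => ?_, fun σ => ?_⟩
  · rw [hTT' σ] at hw
    obtain ⟨w₀, hw₀, rfl⟩ := Multiset.mem_map.mp hw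
    obtain ⟨k, l, hk, hl⟩ := hTC σ w₀ hw₀
    exact ⟨k - HeckeCharacter.embExponent p q σ,
      l - HeckeCharacter.embExponent p q (ComplexEmbedding.conjugate σ),
      by push_cast; rw [hk]; ring, by push_cast; rw [hl]; ring⟩
  · have h := (hTR σ).map (sub_left_injective (b := (HeckeCharacter.embExponent p q σ : ℂ)))
    rw [hTT' σ, Multiset.map_map]
    rw [Multiset.map_map] at h
    exact h

omit [NumberField K] in
/-- The image under an embedding `e : K → ℂ` of an algebraic integer of `K` is an algebraic
integer of `ℂ`. [folklore] -/
theorem isIntegral_embedding_ringOfIntegers (e : K →+* ℂ) (x : 𝓞 K) :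
    IsIntegral ℤ (e (x : K)) :=
  map_isIntegral_int e x.isIntegral_coe

/-- **Stub L `stub_limitTwist` of the line `slope-free-polarized-limit`** (= split child
`LimitTwist`; statement byte-identical with the registered stub): the typed tower for the traces
`e(a_𝔭 f)` ⇒ a tower of the same shape for the twisted traces `e(a_𝔭 f · ϖ_𝔭)` with `ϖ_𝔭` primary
off the (enlarged) exceptional set.  Twist each `P_k` by the CM Grössencharacter `ψ` of conductor
`(3)` (`exists_primaryGen_heckeCharacter_cyclotomicField_three e`): cuspidality by
`exists_cuspidalAutomorphicRepData_twist_hecke`, regular algebraicity by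
`isRegularAlgebraic_twist_hecke`, Satake parameters `e(ϖ_𝔭) · α` off `S ∪ supp 𝔪 ∪ {λ}` by
`HasSatakeParamAt.map_mulChar_detTwist_hecke_of_isUnramifiedAt`, and the congruence datum
`(t, u) ↦ (e(ϖ_𝔭) t, u)`. -/
theorem stub_limitTwist :
    ∀ (f : Polynomial ℤ) (hcpt : Literature.NumberTheory.Automorphic.isCompact_glFiniteIntegralLevel 3 (CyclotomicField 3 ℚ)), f.natDegree = 4 → (f.map (Int.castRingHom ℚ)).Separable → 12 ∣ Nat.card (f.map (Int.castRingHom ℚ)).Gal → (∃ (e : (CyclotomicField 3 ℚ) →+* ℂ) (𝔐 : Ideal (integralClosure ℤ ℂ)) (S : Finset (IsDedekindDomain.HeightOneSpectrum (NumberField.RingOfIntegers (CyclotomicField 3 ℚ)))), 𝔐.IsMaximal ∧ (3 : (integralClosure ℤ ℂ)) ∈ 𝔐 ∧ ∀ k : ℕ, ∃ P : Literature.NumberTheory.Automorphic.CuspidalAutomorphicRepData 3 (CyclotomicField 3 ℚ) hcpt, P.1.IsRegularAlgebraic ∧ ∀ 𝔭 ∉ S, ∃ (α : Multiset ℂ)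 (t u : (integralClosure ℤ ℂ)), P.1.HasSatakeParamAt 𝔭 α ∧ (t : ℂ) = (𝔭.residueCard : ℂ) * α.sum - e (Literature.NumberTheory.GaloisRepresentations.picardTrace f 𝔭) ∧ u ∉ 𝔐 ∧ u * t ∈ Ideal.span {(3 : (integralClosure ℤ ℂ)) ^ k}) → (∃ (e : (CyclotomicField 3 ℚ) →+* ℂ) (𝔐 : Ideal (integralClosure ℤ ℂ)) (S : Finset (IsDedekindDomain.HeightOneSpectrum (NumberField.RingOfIntegers (CyclotomicField 3 ℚ)))) (ϖ : (IsDedekindDomain.HeightOneSpectrum (NumberField.RingOfIntegers (CyclotomicField 3 ℚ))) → (NumberField.RingOfIntegers (CyclotomicField 3 ℚ))), 𝔐.IsMaximal ∧ (3 : (integralClosure ℤ ℂ)) ∈ 𝔐 ∧ (∀ 𝔭 ∉ S, 𝔭.asIdeal = Ideal.span {ϖ 𝔭} ∧ ϖ 𝔭 - 1 ∈ Ideal.span {(3 : (NumberField.RingOfIntegers (CyclotomicField 3 ℚ)))}) ∧ ∀ k : ℕ, ∃ P : Literature.NumberTheory.Automorphic.CuspidalAutomorphicRepData 3 (CyclotomicField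 3 ℚ) hcpt, P.1.IsRegularAlgebraic ∧ ∀ 𝔭 ∉ S, ∃ (α : Multiset ℂ) (t u : (integralClosure ℤ ℂ)), P.1.HasSatakeParamAt 𝔭 α ∧ (t : ℂ) = (𝔭.residueCard : ℂ) * α.sum - e (↑(Literature.NumberTheory.GaloisRepresentations.picardTrace f 𝔭 * ϖ 𝔭)) ∧ u ∉ 𝔐 ∧ u * t ∈ Ideal.span {(3 : (integralClosure ℤ ℂ)) ^ k}) := by
  intro f hcpt _hdeg _hsep _hgal hyp
  obtain ⟨e, 𝔐, S, h𝔐, h3, htower⟩ := hyp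
  -- the CM Grössencharacter `ψ` with `ψ(ϖ_𝔭) = e(ϖ_𝔭)` and the primary generators `ϖ`
  obtain ⟨ϖ, ψ, hψalg, hψ⟩ := exists_primaryGen_heckeCharacter_cyclotomicField_three e
  -- a level `𝔪` of `ψ ∘ det` on `GL₃`
  obtain ⟨𝔪, h𝔪, hψ𝔪⟩ := ψ.exists_level 3
  -- the enlarged exceptional set: `S`, the primes of `𝔪`, the prime(s) above `3`
  have h3ne : (Ideal.span {(3 : 𝓞 (CyclotomicField 3 ℚ))} : Ideal (𝓞 (CyclotomicField 3 ℚ))) ≠ 0 := by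
    rw [Ne, Ideal.zero_eq_bot, Ideal.span_singleton_eq_bot]
    norm_num
  set S₃ : Finset (HeightOneSpectrum (𝓞 (CyclotomicField 3 ℚ))) := (Ideal.finite_factors h3ne).toFinset
    with hS₃
  set S𝔪 : Finset (HeightOneSpectrum (𝓞 (CyclotomicField 3 ℚ))) := (Ideal.finite_factors h𝔪).toFinset
    with hS𝔪
  have hmem3 : ∀ 𝔭 : HeightOneSpectrum (𝓞 (CyclotomicField 3 ℚ)), 𝔭 ∉ S₃ →
      (3 : 𝓞 (CyclotomicField 3 ℚ)) ∉ 𝔭.asIdeal := by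
    intro 𝔭 h𝔭 h3𝔭
    refine h𝔭 ?_
    rw [hS₃, Set.Finite.mem_toFinset, Set.mem_setOf_eq, Ideal.dvd_iff_le, Ideal.span_singleton_le_iff_mem]
    exact h3𝔭
  have hmem𝔪 : ∀ 𝔭 : HeightOneSpectrum (𝓞 (CyclotomicField 3 ℚ)), 𝔭 ∉ S𝔪 → ¬ 𝔭.asIdeal ∣ 𝔪 := by
    intro 𝔭 h𝔭 hdvd
    refine h𝔭 ?_
    rw [hS𝔪, Set.Finite.mem_toFinset, Set.mem_setOf_eq]
    exact hdvd
  refine ⟨e, 𝔐, S ∪ S𝔪 ∪ S₃, ϖ, h𝔐, h3, fun 𝔭 h𝔭 => ?_, fun k => ?_⟩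
  · simp only [Finset.mem_union, not_or] at h𝔭
    exact (hψ 𝔭 (hmem3 𝔭 h𝔭.2)).1
  · obtain ⟨P, hreg, hP⟩ := htower k
    -- the twist `P ⊗ (ψ ∘ det)`
    obtain ⟨P', hW, hW'⟩ := exists_cuspidalAutomorphicRepData_twist_hecke ψ P
    refine ⟨P', isRegularAlgebraic_twist_hecke hψalg hW hW' hreg, fun 𝔭 h𝔭 => ?_⟩
    simp only [Finset.mem_union, not_or] at h𝔭
    obtain ⟨⟨h𝔭S, h𝔭𝔪⟩, h𝔭3⟩ := h𝔭
    obtain ⟨α, t, u, hα, ht, hu, hut⟩ := hP 𝔭 h𝔭S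
    obtain ⟨-, hunr, hval⟩ := hψ 𝔭 (hmem3 𝔭 h𝔭3)
    have hα' := hα.map_mulChar_detTwist_hecke_of_isUnramifiedAt ψ h𝔪 hψ𝔪 (hmem𝔪 𝔭 h𝔭𝔪) hunr hW hW'
    -- the algebraic integer `e(ϖ_𝔭)`
    set z : integralClosure ℤ ℂ := ⟨e (ϖ 𝔭 : CyclotomicField 3 ℚ),
      isIntegral_embedding_ringOfIntegers e (ϖ 𝔭)⟩ with hz
    refine ⟨_, z * t, u, hα', ?_, hu, ?_⟩
    · rw [Multiset.sum_map_mul_left, Multiset.map_id', hval]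
      push_cast
      rw [map_mul, ht, hz]
      ring
    · rw [mul_left_comm]
      exact Ideal.mul_mem_left _ _ hut

end Summit.Langlands.Langlands.Theorems.IrregularClassicality.SlopeFreePolarizedLimit

end
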